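import Mathlib
import Summits.ValiantsHypothesis.ValiantsHypothesis.Theorems.GeneratorObstructionsPowGenDegreeQPGadgetTableauBlockExpo
import Summits.ValiantsHypothesis.ValiantsHypothesis.Theorems.GeneratorObstructionsPowGenDegreeQPPiFiberwise

/-!
# Route GeneratorObstructions — crux K2 `PowGenDegreeQP` (stmt-ValiantsHypothesis-11655), line
# `trace-side-regimes`: regrouping tools for the fibrewise sum (step R3, part 1)

Inputs for the final regrouping of `gadgetTab_fiberSum_eq_pow` (skeleton on the item): the index
set of (column, block) pairs `Σ n, Fin c`, its group map `grp` to `Option (Σ j, Fin 2^j)` (triple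
columns `3kq+i`, pair columns `3k·2^j+3kq+i`, or empty fibre), the facts that `grp = none` forces an
empty fibre (`fibre_isEmpty_of_grp_none`) and that the validity indicator is the product over copies
of the `D*` indicators (`valid_all_iff_copies`), and the count `#(Σ j : Fin c, Fin 2^j) = 2^c - 1`.

Honest framing: combinatorics of one explicit tableau; no stub, crux or summit is settled here;
`VP ≠ VNP` untouched. [folklore]
-/

namespace Summit.ValiantsHypothesis.ValiantsHypothesis.Theorems.GeneratorObstructions.PowGenDegreeQP

open Literature.Computability.AlgebraicComplexity Literature.Computability.AlgebraicComplexity.TableauEval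

-- `Summit.ValiantsHypothesis.ValiantsHypothesis.…` is the tree's mandated single-conjunct layout.
set_option linter.dupNamespace false

noncomputable section

/-- The number of (block, copy) pairs: `Σ_{j<c} 2^j = 2^c - 1`. [folklore] -/
theorem card_copies (c : ℕ) : Fintype.card ((j : Fin c) × Fin (2 ^ j.val)) = 2 ^ c - 1 := by
  rw [Fintype.card_sigma]
  simp only [Fintype.card_fin]
  rw [Fin.sum_univ_eq_sum_range (fun j => 2 ^ j) c]
  induction c with
  | zero => simp
  | succ n ih => rw [Finset.sum_range_succ, ih, pow_succ]; have := Nat.one_le_two_pow (n := n); omega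

variable {σ : Type*}

/-- **Validity of all labels is validity of all copies.** [folklore] -/
theorem valid_all_iff_copies [LinearOrder σ] (k c : ℕ) (hk : 1 ≤ k) (hc : 1 ≤ c) (x : ℕ → σ)
    {N : ℕ} (hx : IsAntitoneEnum x N) (hN : 3 * c ≤ N)
    (ρ : (n : Fin (gadgetTab k c hk hc x).C) → (j : Fin c) →
      Equiv.Perm {r : Fin ((gadgetTab k c hk hc x).h n) // rowBlock k c hk hc x n r = j}) :
    (∀ u : Fin (gadgetTab k c hk hc x).d,
        (gadgetTab k c hk hc x).content (fiberPermPi (rowBlock k c hk hc x) ρ) u =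
          gadgetExp k (fun i : Fin c => x (letterRow c i 2)) (fun i => x (letterRow c i 1))
            (fun i => x (letterRow c i 0)) ⟨labBlock u, (labBlock_lt u).1⟩) ↔
      ∀ jq : (j : Fin c) × Fin (2 ^ j.val),
        blockExpo k (tripleσ k c hk hc x ρ jq.1 jq.2.val jq.2.isLt)
          (pairτ k c hk hc x ρ jq.1 jq.2.val jq.2.isLt) = blockTgt k := by
  constructor
  · intro h jq
    rw [← valid_copy_iff_blockExpo k c hk hc x hx hN ρ jq.1 jq.2.val jq.2.isLt]
    intro ℓ
    have hu := h ⟨labelOf jq.1 jq.2.val ℓ, labelOf_lt jq.1.isLt jq.2.isLt ℓ⟩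
    -- the block of this label is `jq.1`
    have hb : (⟨labBlock (labelOf jq.1.val jq.2.val ℓ), (labBlock_lt (⟨labelOf jq.1 jq.2.val ℓ,
        labelOf_lt jq.1.isLt jq.2.isLt ℓ⟩ : Fin (3 * (2 ^ c - 1)))).1⟩ : Fin c) = jq.1 :=
      Fin.ext (labBlock_labelOf jq.2.isLt ℓ)
    rw [hb] at hu
    exact hu
  · intro h u
    obtain ⟨hj, hq, -⟩ := labBlock_lt u
    have hv := (valid_copy_iff_blockExpo k c hk hc x hx hN ρ ⟨labBlock u, hj⟩ (labCopy u) hq).mpr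
      (h ⟨⟨labBlock u, hj⟩, ⟨labCopy u, hq⟩⟩) (labLab u)
    have hu : (⟨labelOf (labBlock u.val) (labCopy u.val) (labLab u.val),
        labelOf_lt hj hq (labLab u.val)⟩ : Fin (gadgetTab k c hk hc x).d) = u :=
      Fin.ext (labelOf_surj u)
    rw [hu] at hv
    exact hv

end

end Summit.ValiantsHypothesis.ValiantsHypothesis.Theorems.GeneratorObstructions.PowGenDegreeQP
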